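import Literature.MathematicalPhysics.QuantumFieldTheory.Balaban1983to89.B5Eq190FlatCoercivitySpacingUniform

/-!
# `Balaban1983to89.B5Eq190FlatStrongFormTransfer` — T. Bałaban, *Propagators and renormalization transformations for lattice gauge theories. I*,
# Commun. Math. Phys. **95** (1984) 17–40 [Balaban1984PropagatorsI] Prop. 1.1 (1.90) p. 33 WITH ITS GRADIENT ROWS, and (1.69) p. 29 «Δ = ∂*∂ + ∂∂*»,
# FOR *Propagators for lattice gauge theories in a background field*, Commun. Math. Phys. **99** (1985) 389–434 [Balaban1985BackgroundPropagators]
# (3.26) p. 395 ∕ Thm 3.11 p. 416 AT THE FLAT BACKGROUND: THE **STRONG** FLAT FORM OF THE pub-balaban NE9 CHAIN's PRINCIPAL GAUGE-FIXED OPERATOR —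
# `γ₀·(‖D(1)x‖² + ‖D*(1)x‖² + (ηL)⁻²‖x‖²) ≤ re⟨x, (D*D + D R(1) D* + aQ(1)†Q(1)) x⟩`, `γ₀ = 1∕((d+1)·Cst(d,a″))` — THE CURL AND DIVERGENCE ROWS
# THAT (F) `B5Eq190FlatCoercivityUniform` DROPPED AT TRANSFER, NOW TRANSPORTED; VOLUME-FREE, AND ALONG THE CANONICAL WEIGHTS FREE OF `m, L, η, c₀, c₁`

statement-level skeleton of published theorems with citation tags; proofs where landed; nothing here is a claim about the Yang–Mills mass gap

PDF held: `paper:balaban1984-cmp95-propagators-rt-i` pp. 29, 33 via the tree's (F) ∕ `B5Prop11Lower` §5 ∕ `B5Hk163RDiv.DstarD` docstrings (verbatim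
there); `paper:balaban1985-cmp99-background-propagators` pp. 392–395 (p0005 opened by this seat 2026-08-22).
THE PRINT (verbatim).  [B5] p. 33: *«Proposition 1.1. … with a positive constant γ₀ independent of k, T_η, and depending on d only (if we put a = 1).
This implies the bound from below: Δ_a = G⁻¹ ≥ γ₀(Δ + I). (1.90)»*; p. 29 (1.69): *«⟨A, Δ_a A⟩ = ⟨A, ∂*∂A⟩ + ⟨A, ∂R∂*A⟩ + a⟨A, Q*QA⟩ = ⟨A, ΔA⟩ −
⟨A, ∂P∂*A⟩ + a⟨A, Q*QA⟩, Δ = ∂*∂ + ∂∂*, R = I − P»*.  So print's `⟨A, (Δ + I)A⟩` IS `⟨∂A, ∂A⟩ + ⟨∂*A, ∂*A⟩ + ⟨A, A⟩` — curl energy, divergence square,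
mass — and (1.90) is a STRONG (first-order) coercivity, not only `γ₀‖A‖²`.

WHY THIS FILE (cell context).  (F) `B5Eq190FlatCoercivityUniform` (this lineage, gen 59) transported b05's kernel-certified (1.90)
(`B5Prop11Lower.form_LapOne_le`: ALL the rows `V_α`, `α ∈ {none} ∪ Fin d`, of `Δ + I = Σ_α V_α*V_α`) to the NE9 chain's letters — but pulled back the
`V_none = 1` row ONLY (`b05_form_lower`): the chain's small-field step ((C2)∕(C2′)) perturbs off the flat form in OPERATOR norm and consumes `γ₀‖x‖²`
alone.  The NE9 route step R2′∕B7′ of `t4/ROUTES-NE9.md` v13.19 §L1.2 (FORM-relative, Kato-type perturbation, whose error terms are quadratic forms of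
FIRST-order letters, `‖(D_U − D_1)x‖·‖D_1 x‖`, `‖(D*_U − D*_1)x‖·‖D*_1 x‖`) needs exactly the dropped rows: its step S0 «strong flat form transported».
THIS FILE is S0 in HODGE shape: the chain types no flat forward difference of BOND functions, but it types the flat curl `covCurlL2K … 1` and the flat
divergence `covDivL2K … 1`, and by (1.69)'s «Δ = ∂*∂ + ∂∂*» — in the tree the DEFINITION `B5Hk163RDiv.DstarD := Lap − ∂∂*` with
`B5Hk164Transl.form_eq_cEnergy` — print's `⟨A,(Δ+I)A⟩` is `cEnergy A + ‖∂*A‖² + ‖A‖²` on b05's carrier, which the dictionary of `B5Eq190FlatFormTransfer`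
carries to `c₀⁻¹(ηL)²·(‖D(1)f‖² + ‖D*(1)f‖²) + c₀⁻¹‖f‖²` for `f = A ∘ cast`.

WHAT IS PROVED (sorry-free; 0 `def`; (1.90) enters as the tree THEOREM `B5Prop11Lower.form_LapOne_le`, nothing of the papers asserted).
* §1 (b05 side) **`sum_nsq_Vb_eq_hodge`**: `Σ_α ‖V_α A‖² = cEnergy A + ‖∂*A‖² + ‖A‖²` ((1.69)'s «Δ = ∂*∂ + ∂∂*» + `I`; [folklore] bookkeeping on
  `B5Prop11Lower.form_LapOne`, `B5Hk163RDiv.DstarD`); **`b05_strong_form_lower`**: `γ(d,a)·(cEnergy A + ‖∂*A‖² + Σ‖A w‖²) ≤ re(star A ⬝ᵥ Δ_a A)`,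
  `γ(d,a) = 1∕((d+1)·Cst d a)` — (1.90) with ALL rows, volume- and torus-free as b05 certified it.
* §2 (dictionary) **`norm_sq_covDiv_one_pullback`**: `‖D*_{η⁻¹}(1)(A ∘ cast)‖²_{L²(c₀)} = c₀·(ηL)⁻²·‖∂*_{(L)} A‖²` — the UN-projected twin of
  `B5Eq190FlatFormTransfer.norm_sq_RofU_covDiv_pullback` (`D* ↔ GradOpᴴ`, `B9Eq315FlatDictionary` §5).
* §3 (scalar fields) **`flat_strong_coercive_scalar`**: `γ(d,a″)·(‖D(1)y‖² + ‖D*(1)y‖² + (ηL)⁻²‖y‖²) ≤ re⟨y, Δ_{1,a}(1)^{ℂ} y⟩`, `a″ = a·c₁·(ηL)²∕(c₀L^d)`.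
* §4 (`𝔤ᶜ`-valued fields) **`flat_strong_coercive_uniform`**: the same for every finite-dimensional Hilbert fibre `W` and reading `φ : W ≃ 𝔸` (Parseval
  `B5Eq172FlatFibreNaturality.sum_norm_sq_coord` on the three squares: `coord_covCurlL2K_one`, `coord_covDivL2K_one`, and (F) §5 `re_inner_flat_eq_sum_coord`).
* §5 (Bałaban's normalisation) **`flat_strong_coercive_canonical`**: along `c₁·(ηL)² = c₀·L^d` with blocks of side `0 < ηL ≤ 1`: `a″ = a` and
  `γ(d,a)·(‖D(1)x‖² + ‖D*(1)x‖² + ‖x‖²) ≤ re⟨x, Δ_{1,a}(1)x⟩` — free of `m, L, η, c₀, c₁`; **`exists_strong_coercive_flat_canonical`** (`∃ γ` BEFORE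
  `∀ L ∀ η ∀ c₀ c₁ ∀ m`); §6 **`flat_strong_coercive_linear`** (its canonical specialisation is immediate, not filed): the same with ne9-leaf-04's LINEAR constant
  `γ(d,1)·min(a″,1)` (`B5Eq190FlatCoercivitySpacingUniform.min_mul_re_inner_flat_le` BY NAME — the right small-`a` order).
MODEL ∕ DECLARED READINGS.  (M1) exactly (F)'s: one averaging step on `TSite d (L·m)`, fine weight `c₀`, coarse weight `c₁`, scalar `η⁻¹`; b05's torus
under the def-free cast; the `(ηL)⁻²` on the mass row is the block-side rescaling of the dictionary (b05's derivative scale is `n = L`, the chain's `η⁻¹`);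
the DERIVATIVE rows carry NO such factor — curl and divergence squares scale like the form.  (M2) no hypothesis of the papers displayed; `η ≠ 0`, `0 < a`,
`1 ≤ L` (§5: `0 < ηL ≤ 1` and the weight relation DISPLAYED, as in (F″)).  (M3) NOT HERE: print's FULL gradient `Σ_ν‖∇_ν A‖²` as a chain-side object
(untyped in the chain; the Hodge form `‖D A‖² + ‖D*A‖²` is what it equals on the flat torus, (1.69), and what B7′'s S1∕S4 consume); (1.89)'s bounds for `G`;
the multi-level operators (3.16)∕(3.24); ANY background `U ≠ 1` — B7′-1 (strong coercivity at a small field) is NOT claimed, this is its flat input only.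
HONEST SCOPE.  ONE printed inequality ([B5] (1.90), kernel-certified on b05's carrier with all its rows) transported with two more squares than (F);
[folklore] bookkeeping between two typed carriers of one printed lattice; nothing of [B9] Thm 3.11 at `U ≠ 1` asserted; «NE9 ⇐ the named binders»; NE9 NOT
PRINTED ∕ NOT PROVED; NOT summit progress (cell pub-balaban: spine PROVED 0/9; rung (B)+1 finite T⁴ — NOT infinite volume, NOT mass gap, NOT Clay; HONEST
DEPENDENCY: continuum YM on T⁴ ⇐ BetaPertH ∧ nine spine estimates (0/9 proved); BetaPertH ⇐ (D1) ∧ (D4) ∧ CAP+tail; G-an2-4 gates asym, D1 and NE2/3/4).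
Unit `b2b-balaban-t4-ne9-formalise-leaf-03` (NE9 crux-team leaf prover, gen 62), INTENT I-ne9leaf03-g62-1 = ROUTES-NE9 v13.19 R2′ STEP B7′ S0 (hand-off
[NE9IDEA1-G82-INBOX]: first refusal ne9-leaf-04, honoured); NEW file importing (F″) `B5Eq190FlatCoercivitySpacingUniform` only; modifies nothing.  Net new unproved facts: 0.
-/

noncomputable section

open scoped BigOperators InnerProductSpace ComplexConjugate Matrix

namespace Literature.MathematicalPhysics.QuantumFieldTheory.Balaban1983to89.B5Eq190FlatStrongFormTransfer

open B4Sect5Torus (TSite)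
open B9SectCLatticeCarrier (Bond)
open B9Eq311L2Pairing (WL2)
open B9Eq319QprimeTorus (fineP)
open B11Eq103H1Complex (SiteL2K BondL2K covDivL2K laplaceALatticeK)
open B9Eq310HessianOperator (adTransportW principalOpK covCurlL2K)
open B9Eq326OperatorAssembly (RofU)
open B9Eq315QTorus (perCfg cornerSite QtorusW)
open B7Prop1Explicit (U1 Wcx boxVec)
open B5Prop11Plancherel (Tor fine)
open B5Prop11Lower (nsq Vb Lap)
open B5Action121 (GradOp)
open B5Hk163RDiv (DstarD)
open B5Hk164Transl (cEnergy form_eq_cEnergy star_dotProduct_mulVec_eq)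
open B5Eq172HodgePositivity (re_inner_principalOpK_one)
open B5Eq172FlatCoercivity (hU1_one hreg_one)
open B5Eq172FlatFibreNaturality (sum_norm_sq_coord coord_covCurlL2K_one coord_covDivL2K_one)
open B5Eq190FlatFormTransfer (re_inner_principalOpK_one_pullback re_inner_laplaceA_one_pullback norm_sq_pullback covDivL2K_scalar)
open B5Eq190FlatCoercivityUniform (re_inner_flat_eq_sum_coord)
open B5Eq190FlatCoercivitySpacingUniform (min_mul_re_inner_flat_le)
open B9Eq321FlatProjectionDictionary (sum_torCast)
open B9Eq315FlatDictionary (torCast_bijective)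

variable {d : ℕ}

/-! ## §1 b05 side: `⟨A, (Δ + I)A⟩ = cEnergy A + ‖∂*A‖² + ‖A‖²` ((1.69): `Δ = ∂*∂ + ∂∂*`) and (1.90) with all rows -/

section B05

variable (L : ℕ) [NeZero L] (m : Fin d → ℕ) [∀ i, NeZero (m i)]

/-- **(1.69)'s `Δ = ∂*∂ + ∂∂*`, PLUS THE IDENTITY, IN SQUARES**: `Σ_α ‖V_α A‖² = cEnergy A + ‖∂*A‖² + ‖A‖²` for b05's rows `V_none = 1`, `V_ν = ∇_ν`
(`B5Prop11Lower.form_LapOne`: `A*(Δ + I)A = Σ_α‖V_αA‖²` with the componentwise `Δ = Σ_ν∇_ν*∇_ν`; `B5Hk163RDiv.DstarD := Δ − ∂∂*` whose form is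
`cEnergy A = ½Σ|F_{μν}|²` by `B5Hk164Transl.form_eq_cEnergy`; `A*∂∂*A = ‖∂*A‖²`). [cite: Balaban1984PropagatorsI, (1.69) p.29, (1.21) p.21] -/
theorem sum_nsq_Vb_eq_hodge (A : Tor (fine L m) × Fin d → ℂ) :
    ∑ α, nsq (Vb L m α *ᵥ A) = cEnergy L m A + nsq ((GradOp (fine L m) (L : ℂ))ᴴ *ᵥ A) + nsq A := by
  apply Complex.ofReal_injective
  have hLap : Lap L m = DstarD L m + GradOp (fine L m) (L : ℂ) * (GradOp (fine L m) (L : ℂ))ᴴ := by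
    rw [DstarD, sub_add_cancel]
  rw [← B5Prop11Lower.form_LapOne, hLap, Matrix.add_mulVec, Matrix.add_mulVec, Matrix.one_mulVec, ← Matrix.mulVec_mulVec,
    dotProduct_add, dotProduct_add, form_eq_cEnergy, star_dotProduct_mulVec_eq (GradOp (fine L m) (L : ℂ)) A,
    B5Prop11Lower.star_dotProduct_self, B5Prop11Lower.star_dotProduct_self]
  push_cast
  ring

/-- **b05's UNIFORM (1.90) WITH ALL ITS ROWS, AS A FORM INEQUALITY**: `γ(d,a)·(cEnergy A + ‖∂*A‖² + Σ_w‖A w‖²) ≤ re(star A ⬝ᵥ Δ_a A)`,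
`γ(d,a) = 1∕((d+1)·Cst d a)` — independent of `n = L` and of the torus (`B5Prop11Lower.form_LapOne_le` + `B5DeltaA169.calDa_eq_DeltaA` + §1's Hodge
reading of `Δ + I`); (F)'s `b05_form_lower` is its last row. [cite: Balaban1984PropagatorsI, Prop. 1.1 (1.90) p.33, (1.69) p.29] -/
theorem b05_strong_form_lower (hL : 1 ≤ L) {a : ℝ} (ha : 0 < a) (A : Tor (fine L m) × Fin d → ℂ) :
    (1 / ((d + 1 : ℝ) * B5Prop11Plancherel.Cst d a)) * (cEnergy L m A + nsq ((GradOp (fine L m) (L : ℂ))ᴴ *ᵥ A) + ∑ w, ‖A w‖ ^ 2) ≤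
      (star A ⬝ᵥ (B5DeltaA169.DeltaA L m a).mulVec A).re := by
  have hC1 : (1 : ℝ) ≤ B5Prop11Plancherel.Cst d a := B5Prop11Lower.one_le_Cst a
  have hC : 0 < (d + 1 : ℝ) * B5Prop11Plancherel.Cst d a := by positivity
  have h0 := B5Prop11Lower.form_LapOne_le L hL m a ha A
  rw [B5DeltaA169.calDa_eq_DeltaA L hL m a ha, sum_nsq_Vb_eq_hodge] at h0
  rw [one_div, inv_mul_le_iff₀ hC]
  exact h0

end B05

/-! ## §2 The dictionary for the divergence square: `‖D*(1)f‖² = c₀·(ηL)⁻²·‖∂*A‖²` -/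

section DivSquare

variable (L : ℕ) [NeZero L] (m : Fin d → ℕ) [∀ i, NeZero (m i)] [∀ i, NeZero (fineP L m i)] {c₀ : ℝ} [Fact (0 < c₀)]

omit [∀ i, NeZero (m i)] in
/-- **THE DIVERGENCE SQUARE UNDER THE DICTIONARY**: `‖D*_{η⁻¹}(1)(A ∘ cast)‖²_{L²(c₀)} = c₀·(ηL)⁻²·Σ_z|(∂*_{(L)}A)(z)|²` — the chain's flat divergence
of a pulled-back scalar bond function is b05's `GradOpᴴ` at scalar `L` (`B9Eq315FlatDictionary.GradOp_conjTranspose_mulVec_eq_covDiv_flat`), rescaled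
by `η⁻¹∕L` (`B5Eq190FlatFormTransfer.covDivL2K_scalar`); the UN-projected twin of `B5Eq190FlatFormTransfer.norm_sq_RofU_covDiv_pullback`.
[cite: Balaban1985BackgroundPropagators, (3.8) p.392, (3.11) p.392; Balaban1984PropagatorsI, (1.21) p.21] -/
theorem norm_sq_covDiv_one_pullback (η : ℝ) (A : Tor (fine L m) × Fin d → ℂ) :
    ‖covDivL2K ℂ c₀ ((η : ℂ))⁻¹ (adTransportW (LinearEquiv.refl ℂ ℂ) fun _ : Bond d (fineP L m) => (1 : ℂˣ)⁻¹)
        ((WL2.linearEquiv ℂ ℂ (fun _ : Bond d (fineP L m) => c₀)).symm (fun b => A (fun i => ((b.1 i : ℕ) : ZMod (fineP L m i)), b.2)))‖ ^ 2 =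
      c₀ * ((η * L)⁻¹) ^ 2 * nsq ((GradOp (fineP L m) (L : ℂ))ᴴ *ᵥ A) := by
  have hL0 : (L : ℂ) ≠ 0 := by exact_mod_cast NeZero.ne L
  have hLr : (0 : ℝ) < L := by exact_mod_cast Nat.pos_of_ne_zero (NeZero.ne L)
  set g : Tor (fine L m) → ℂ := (GradOp (fineP L m) (L : ℂ))ᴴ *ᵥ A with hg
  have hS : (adTransportW (LinearEquiv.refl ℂ ℂ) fun _ : Bond d (fineP L m) => (1 : ℂˣ)⁻¹) = fun _ => LinearMap.id :=
    funext fun b => B5Eq172HodgePositivity.adTransportW_inv_one _ b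
  -- the flat divergence at scalar `L`, pulled back (as in `B5Eq190FlatFormTransfer` §5)
  have hDL : covDivL2K ℂ c₀ (L : ℂ) (adTransportW (LinearEquiv.refl ℂ ℂ) fun _ : Bond d (fineP L m) => (1 : ℂˣ)⁻¹)
        ((WL2.linearEquiv ℂ ℂ (fun _ : Bond d (fineP L m) => c₀)).symm (fun b => A (fun i => ((b.1 i : ℕ) : ZMod (fineP L m i)), b.2))) =
      (WL2.linearEquiv ℂ ℂ (fun _ : TSite d (fineP L m) => c₀)).symm (fun x => g (fun i => ((x i : ℕ) : ZMod (fineP L m i)))) := by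
    apply (WL2.equiv ℂ (fun _ : TSite d (fineP L m) => c₀) ℂ).injective
    funext x
    rw [B11Eq103H1Complex.equiv_covDivL2K, hS, WL2.linearEquiv_symm_apply, Equiv.apply_symm_apply, WL2.linearEquiv_symm_apply,
      Equiv.apply_symm_apply, hg, B9Eq315FlatDictionary.GradOp_conjTranspose_mulVec_eq_covDiv_flat (fineP L m) (L : ℂ) (by simp) A x]
  -- rescale the scalar `η⁻¹ = (η⁻¹/L)·L`
  have hsc : ((η : ℂ))⁻¹ = (((η : ℂ))⁻¹ / (L : ℂ)) * (L : ℂ) := by rw [div_mul_cancel₀ _ hL0]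
  have hfac : ‖((η : ℂ))⁻¹ / (L : ℂ)‖ ^ 2 = ((η * L)⁻¹) ^ 2 := by
    rw [norm_div, norm_inv, Complex.norm_real, Complex.norm_natCast, Real.norm_eq_abs, ← sq_abs (η * L)⁻¹, abs_inv, abs_mul,
      abs_of_pos hLr, div_eq_mul_inv, ← mul_inv]
  rw [hsc, covDivL2K_scalar, LinearMap.smul_apply, hDL, norm_smul, mul_pow, hfac,
    WL2.norm_sq (𝕜 := ℂ) (w := fun _ : TSite d (fineP L m) => c₀) (V := ℂ), ← Finset.mul_sum]
  have hsum : ∑ x : TSite d (fineP L m), ‖WL2.equiv ℂ (fun _ : TSite d (fineP L m) => c₀) ℂ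
      ((WL2.linearEquiv ℂ ℂ (fun _ : TSite d (fineP L m) => c₀)).symm (fun x => g (fun i => ((x i : ℕ) : ZMod (fineP L m i))))) x‖ ^ 2 =
      nsq g := by
    simp only [WL2.linearEquiv_symm_apply, Equiv.apply_symm_apply]
    exact sum_torCast (fineP L m) (fun z => ‖g z‖ ^ 2)
  rw [hsum]
  ring

end DivSquare

/-! ## §3 Scalar fields: the strong flat form of the chain with b05's uniform constant -/

section Scalar

variable (L : ℕ) [NeZero L] (m : Fin d → ℕ) [∀ i, NeZero (m i)] [∀ i, NeZero (fineP L m i)] (hL : 1 ≤ L) {c₀ c₁ : ℝ} [Fact (0 < c₀)] [Fact (0 < c₁)]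
  {α' : ℝ} (hα1' : α' ≤ 1 / 64)
  (hU1' : ∀ (x : B7Prop1Explicit.Site d) (κ : Fin d), perCfg (fineP L m) (fun _ : Bond d (fineP L m) => (1 : ℂˣ)) x κ ∈ U1 ℂ)
  (hreg' : ∀ (y : TSite d m) (κ : Fin d) (r : Fin d → Fin L),
    ‖((Wcx L (perCfg (fineP L m) (fun _ : Bond d (fineP L m) => (1 : ℂˣ))) (cornerSite L y) κ (boxVec L r) : ℂˣ) : ℂ) - 1‖ ≤ α')
  {η : ℝ} (hη : η ≠ 0) {a : ℝ} (ha : 0 < a)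

include hη ha

/-- **THE STRONG FLAT FORM ON SCALAR FIELDS** — every scalar bond function `y` is a pull-back `A ∘ cast` (`B9Eq315FlatDictionary.torCast_bijective`);
its curl square is `c₀(ηL)⁻²·cEnergy A` (`B5Eq190FlatFormTransfer.re_inner_principalOpK_one_pullback` with `B5Eq172HodgePositivity.re_inner_principalOpK_one`),
its divergence square `c₀(ηL)⁻²·‖∂*A‖²` (§2), its norm `c₀·Σ‖A w‖²`, its flat form `c₀(ηL)⁻²·re(star A ⬝ᵥ Δ_{a″} A)` (`a″ = a·c₁·(ηL)²∕(c₀·L^d)`),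
and §1 gives `γ(d,a″)·(‖D(1)y‖² + ‖D*(1)y‖² + (ηL)⁻²‖y‖²) ≤ re⟨y, (D*D + D R(1) D* + aQ(1)†Q(1))^{ℂ} y⟩`.
[cite: Balaban1984PropagatorsI, Prop. 1.1 (1.90) p.33, (1.69) p.29; Balaban1985BackgroundPropagators, (3.10) p.392, (3.26) p.395, Thm 3.11 p.416] -/
theorem flat_strong_coercive_scalar (y : BondL2K ℂ d (fineP L m) c₀ ℂ) :
    (1 / ((d + 1 : ℝ) * B5Prop11Plancherel.Cst d (a * c₁ * (η * L) ^ 2 / (c₀ * (L : ℝ) ^ d)))) *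
        (‖covCurlL2K ℂ c₀ ((η : ℂ))⁻¹ (adTransportW (LinearEquiv.refl ℂ ℂ) (fun _ : Bond d (fineP L m) => (1 : ℂˣ))) y‖ ^ 2 +
          ‖covDivL2K ℂ c₀ ((η : ℂ))⁻¹ (adTransportW (LinearEquiv.refl ℂ ℂ) fun _ : Bond d (fineP L m) => (1 : ℂˣ)⁻¹) y‖ ^ 2 +
          ((η * L)⁻¹) ^ 2 * ‖y‖ ^ 2) ≤
      RCLike.re ⟪y, laplaceALatticeK ((η : ℂ))⁻¹ (adTransportW (LinearEquiv.refl ℂ ℂ) (fun _ : Bond d (fineP L m) => (1 : ℂˣ)))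
          (adTransportW (LinearEquiv.refl ℂ ℂ) fun _ : Bond d (fineP L m) => (1 : ℂˣ)⁻¹)
          (principalOpK (LinearEquiv.refl ℂ ℂ) η fun _ : Bond d (fineP L m) => (1 : ℂˣ))
          (RofU L m (LinearEquiv.refl ℂ ℂ) η (fun _ : Bond d (fineP L m) => (1 : ℂˣ)))
          (QtorusW L m hL (LinearEquiv.refl ℂ ℂ) (fun _ => 1) hα1' hU1' hreg' (c₁ := c₁)) a y⟫_ℂ := by
  have hc₀ : 0 < c₀ := Fact.out
  have hc₁ : 0 < c₁ := Fact.out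
  have hLr : (0 : ℝ) < L := by exact_mod_cast Nat.pos_of_ne_zero (NeZero.ne L)
  -- every scalar bond function is a pull-back along the site dictionary
  set A : Tor (fine L m) × Fin d → ℂ :=
    fun w => WL2.equiv ℂ _ ℂ y (Function.surjInv (torCast_bijective (fineP L m)).surjective w.1, w.2) with hA
  have hy : (WL2.linearEquiv ℂ ℂ (fun _ : Bond d (fineP L m) => c₀)).symm
      (fun b => A (fun i => ((b.1 i : ℕ) : ZMod (fineP L m i)), b.2)) = y := by
    apply (WL2.equiv ℂ (fun _ : Bond d (fineP L m) => c₀) ℂ).injective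
    funext b
    rw [WL2.linearEquiv_symm_apply, Equiv.apply_symm_apply, hA]
    dsimp only
    rw [Function.leftInverse_surjInv (torCast_bijective (fineP L m)) b.1]
  set a'' : ℝ := a * c₁ * (η * L) ^ 2 / (c₀ * (L : ℝ) ^ d) with ha''
  have ha''pos : 0 < a'' := by positivity
  -- the three squares and the norm under the dictionary
  have hcurl : ‖covCurlL2K ℂ c₀ ((η : ℂ))⁻¹ (adTransportW (LinearEquiv.refl ℂ ℂ) (fun _ : Bond d (fineP L m) => (1 : ℂˣ))) y‖ ^ 2 =
      c₀ * ((η * L)⁻¹) ^ 2 * cEnergy L m A := by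
    rw [← re_inner_principalOpK_one (LinearEquiv.refl ℂ ℂ) η, ← hy]
    exact re_inner_principalOpK_one_pullback L m η A
  have hdiv : ‖covDivL2K ℂ c₀ ((η : ℂ))⁻¹ (adTransportW (LinearEquiv.refl ℂ ℂ) fun _ : Bond d (fineP L m) => (1 : ℂˣ)⁻¹) y‖ ^ 2 =
      c₀ * ((η * L)⁻¹) ^ 2 * nsq ((GradOp (fineP L m) (L : ℂ))ᴴ *ᵥ A) := by
    rw [← hy]
    exact norm_sq_covDiv_one_pullback L m η A
  have hnorm : ‖y‖ ^ 2 = c₀ * ∑ w : Tor (fine L m) × Fin d, ‖A w‖ ^ 2 := by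
    rw [← hy]
    exact norm_sq_pullback L m A
  have hform : RCLike.re ⟪y, laplaceALatticeK ((η : ℂ))⁻¹ (adTransportW (LinearEquiv.refl ℂ ℂ) (fun _ : Bond d (fineP L m) => (1 : ℂˣ)))
          (adTransportW (LinearEquiv.refl ℂ ℂ) fun _ : Bond d (fineP L m) => (1 : ℂˣ)⁻¹)
          (principalOpK (LinearEquiv.refl ℂ ℂ) η fun _ : Bond d (fineP L m) => (1 : ℂˣ))
          (RofU L m (LinearEquiv.refl ℂ ℂ) η (fun _ : Bond d (fineP L m) => (1 : ℂˣ)))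
          (QtorusW L m hL (LinearEquiv.refl ℂ ℂ) (fun _ => 1) hα1' hU1' hreg' (c₁ := c₁)) a y⟫_ℂ =
      c₀ * ((η * L)⁻¹) ^ 2 * (star A ⬝ᵥ (B5DeltaA169.DeltaA L m a'').mulVec A).re := by
    rw [← hy, re_inner_laplaceA_one_pullback L m hL hα1' hU1' hreg' hη a A, B5Hk164Transl.re_form_DeltaA, ha'']
    field_simp
  rw [hcurl, hdiv, hnorm, hform]
  -- b05's uniform (1.90) with all rows, at `a″`
  have hb := b05_strong_form_lower L m hL ha''pos A
  have hpos : 0 ≤ c₀ * ((η * L)⁻¹) ^ 2 := by positivity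
  have key := mul_le_mul_of_nonneg_left hb hpos
  linarith [key]

end Scalar

/-! ## §4 `𝔤ᶜ`-valued fields: the strong flat form for every Hilbert fibre (Parseval on the three squares) -/

section Fibre

variable (L : ℕ) [NeZero L] (m : Fin d → ℕ) [∀ i, NeZero (fineP L m i)] (hL : 1 ≤ L) {c₀ c₁ : ℝ} [Fact (0 < c₀)] [Fact (0 < c₁)]
  {𝔸 : Type*} [NormedRing 𝔸] [NormedAlgebra ℂ 𝔸] [CompleteSpace 𝔸] [NormOneClass 𝔸]
  {W : Type*} [NormedAddCommGroup W] [InnerProductSpace ℂ W] [FiniteDimensional ℂ W] (φ : W ≃ₗ[ℂ] 𝔸)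
  {α : ℝ} (hα1 : α ≤ 1 / 64)
  (hU1 : ∀ (x : B7Prop1Explicit.Site d) (κ : Fin d), perCfg (fineP L m) (fun _ : Bond d (fineP L m) => (1 : 𝔸ˣ)) x κ ∈ U1 𝔸)
  (hreg : ∀ (y : TSite d m) (κ : Fin d) (r : Fin d → Fin L),
    ‖((Wcx L (perCfg (fineP L m) (fun _ : Bond d (fineP L m) => (1 : 𝔸ˣ))) (cornerSite L y) κ (boxVec L r) : 𝔸ˣ) : 𝔸) - 1‖ ≤ α)
  {η : ℝ} (hη : η ≠ 0) {a : ℝ} (ha : 0 < a)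

include hη ha

/-- **[B5] PROP. 1.1 (1.90) WITH ITS GRADIENT ROWS FOR THE NE9 CHAIN's FLAT PRINCIPAL GAUGE-FIXED OPERATOR ON `𝔤ᶜ`-VALUED FIELDS — THE STRONG
FLAT FORM, VOLUME-FREE**: for every finite-dimensional Hilbert fibre `W`, every reading `φ : W ≃ 𝔸`, every flat regularity letter, every volume `m`:
`γ(d,a″)·(‖D(1)x‖² + ‖D*(1)x‖² + (ηL)⁻²‖x‖²) ≤ re⟨x, (D*D + D R(1) D* + aQ(1)†Q(1)) x⟩`, `a″ = a·c₁·(ηL)²∕(c₀L^d)`, `γ(d,a) = 1∕((d+1)·Cst d a)`,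
`D(1) = covCurlL2K … 1` (the flat plaquette field (3.4)), `D*(1) = covDivL2K … 1` (the flat divergence (3.8)) — (F)'s `flat_coercive_uniform` is the
last row.  Proof: Parseval over `stdOrthonormalBasis ℂ W` on each square (`B5Eq172FlatFibreNaturality`) and §3 coordinate by coordinate.
[cite: Balaban1984PropagatorsI, Prop. 1.1 (1.90) p.33, (1.69) p.29, (1.72) p.30; Balaban1985BackgroundPropagators, (3.4) p.391, (3.8) p.392, (3.26) p.395, Thm 3.11 p.416] -/
theorem flat_strong_coercive_uniform (x : BondL2K ℂ d (fineP L m) c₀ W) :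
    (1 / ((d + 1 : ℝ) * B5Prop11Plancherel.Cst d (a * c₁ * (η * L) ^ 2 / (c₀ * (L : ℝ) ^ d)))) *
        (‖covCurlL2K ℂ c₀ ((η : ℂ))⁻¹ (adTransportW φ (fun _ : Bond d (fineP L m) => (1 : 𝔸ˣ))) x‖ ^ 2 +
          ‖covDivL2K ℂ c₀ ((η : ℂ))⁻¹ (adTransportW φ fun _ : Bond d (fineP L m) => (1 : 𝔸ˣ)⁻¹) x‖ ^ 2 +
          ((η * L)⁻¹) ^ 2 * ‖x‖ ^ 2) ≤
      RCLike.re ⟪x, laplaceALatticeK ((η : ℂ))⁻¹ (adTransportW φ (fun _ : Bond d (fineP L m) => (1 : 𝔸ˣ)))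
        (adTransportW φ fun _ : Bond d (fineP L m) => (1 : 𝔸ˣ)⁻¹) (principalOpK φ η fun _ => 1) (RofU L m φ η fun _ => 1)
        (QtorusW L m hL φ (fun _ => 1) hα1 hU1 hreg (c₁ := c₁)) a x⟫_ℂ := by
  -- `L·m_i ≠ 0 ⇒ m_i ≠ 0` (the b05 torus of the scalar transfer needs it; the statement does not)
  haveI : ∀ i, NeZero (m i) := fun i => ⟨right_ne_zero_of_mul (NeZero.ne (fineP L m i))⟩
  rw [re_inner_flat_eq_sum_coord L m hL φ hα1 hU1 hreg (show (0 : ℝ) ≤ 1 / 64 by norm_num) (hU1_one L m) (hreg_one L m) η a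
      (stdOrthonormalBasis ℂ W) x,
    ← sum_norm_sq_coord (stdOrthonormalBasis ℂ W) x,
    ← sum_norm_sq_coord (stdOrthonormalBasis ℂ W) (covCurlL2K ℂ c₀ ((η : ℂ))⁻¹ (adTransportW φ (fun _ : Bond d (fineP L m) => (1 : 𝔸ˣ))) x),
    ← sum_norm_sq_coord (stdOrthonormalBasis ℂ W) (covDivL2K ℂ c₀ ((η : ℂ))⁻¹ (adTransportW φ fun _ : Bond d (fineP L m) => (1 : 𝔸ˣ)⁻¹) x),
    Finset.mul_sum, ← Finset.sum_add_distrib, ← Finset.sum_add_distrib, Finset.mul_sum]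
  refine Finset.sum_le_sum fun k _ => ?_
  rw [coord_covCurlL2K_one L m φ ((η : ℂ))⁻¹ (stdOrthonormalBasis ℂ W k) x, coord_covDivL2K_one L m φ ((η : ℂ))⁻¹ (stdOrthonormalBasis ℂ W k) x]
  exact flat_strong_coercive_scalar L m hL (show (0 : ℝ) ≤ 1 / 64 by norm_num) (hU1_one L m) (hreg_one L m) hη ha _

omit [NeZero L] [Fact (0 < c₀)] [Fact (0 < c₁)] hη ha in
/-- The strong constant is positive. [cite: Balaban1984PropagatorsI, Prop. 1.1 (1.90) p.33] -/
theorem strongConst_pos : 0 < 1 / ((d + 1 : ℝ) * B5Prop11Plancherel.Cst d (a * c₁ * (η * L) ^ 2 / (c₀ * (L : ℝ) ^ d))) := by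
  have hC : (1 : ℝ) ≤ B5Prop11Plancherel.Cst d (a * c₁ * (η * L) ^ 2 / (c₀ * (L : ℝ) ^ d)) := B5Prop11Lower.one_le_Cst _
  positivity

/-- **§6-bis, THE LINEAR CONSTANT** (ne9-leaf-04's (F″) device BY NAME): the flat form is monotone ∕ sub-linear in the averaging weight
(`B5Eq190FlatCoercivitySpacingUniform.min_mul_re_inner_flat_le`), so §4 read at the ONE weight `a₀ := c₀L^d∕(c₁(ηL)²)` (`a₀″ = 1`) gives
`(γ(d,1)·min(a″,1))·(‖D(1)x‖² + ‖D*(1)x‖² + (ηL)⁻²‖x‖²) ≤ re⟨x, Δ_{1,a}(1)x⟩` — the right small-`a` order (cf. [B4] (2.27)'s `min{π², a_k}`).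
[cite: Balaban1984PropagatorsI, Prop. 1.1 (1.90) p.33; Balaban1983RegularityDecay, (2.27) p.580; Balaban1985BackgroundPropagators, (3.26) p.395, Thm 3.11 p.416] -/
theorem flat_strong_coercive_linear (x : BondL2K ℂ d (fineP L m) c₀ W) :
    (1 / ((d + 1 : ℝ) * B5Prop11Plancherel.Cst d 1)) * min (a * c₁ * (η * L) ^ 2 / (c₀ * (L : ℝ) ^ d)) 1 *
        (‖covCurlL2K ℂ c₀ ((η : ℂ))⁻¹ (adTransportW φ (fun _ : Bond d (fineP L m) => (1 : 𝔸ˣ))) x‖ ^ 2 +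
          ‖covDivL2K ℂ c₀ ((η : ℂ))⁻¹ (adTransportW φ fun _ : Bond d (fineP L m) => (1 : 𝔸ˣ)⁻¹) x‖ ^ 2 +
          ((η * L)⁻¹) ^ 2 * ‖x‖ ^ 2) ≤
      RCLike.re ⟪x, laplaceALatticeK ((η : ℂ))⁻¹ (adTransportW φ (fun _ : Bond d (fineP L m) => (1 : 𝔸ˣ)))
        (adTransportW φ fun _ : Bond d (fineP L m) => (1 : 𝔸ˣ)⁻¹) (principalOpK φ η fun _ => 1) (RofU L m φ η fun _ => 1)
        (QtorusW L m hL φ (fun _ => 1) hα1 hU1 hreg (c₁ := c₁)) a x⟫_ℂ := by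
  have hc₀ : 0 < c₀ := Fact.out
  have hc₁ : 0 < c₁ := Fact.out
  have hLr : (0 : ℝ) < L := by exact_mod_cast Nat.pos_of_ne_zero (NeZero.ne L)
  have hηL : 0 < (η * L) ^ 2 := by positivity
  -- the weight `a₀` at which `a₀″ = 1`
  set a₀ : ℝ := c₀ * (L : ℝ) ^ d / (c₁ * (η * L) ^ 2) with ha₀
  have ha₀pos : 0 < a₀ := by positivity
  have ha₀'' : a₀ * c₁ * (η * L) ^ 2 / (c₀ * (L : ℝ) ^ d) = 1 := by
    rw [ha₀]; field_simp
  have hratio : a / a₀ = a * c₁ * (η * L) ^ 2 / (c₀ * (L : ℝ) ^ d) := by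
    rw [ha₀]; field_simp
  -- §4 at `a₀`, then the monotonicity in the weight
  have h0 := flat_strong_coercive_uniform L m hL φ (c₁ := c₁) hα1 hU1 hreg hη ha₀pos x
  rw [ha₀''] at h0
  have hmono := min_mul_re_inner_flat_le L m hL φ (c₁ := c₁) hα1 hU1 hreg η (a := a) ha₀pos x
  rw [hratio] at hmono
  have hmin0 : 0 ≤ min (a * c₁ * (η * L) ^ 2 / (c₀ * (L : ℝ) ^ d)) 1 := le_min (by positivity) zero_le_one
  have key := mul_le_mul_of_nonneg_left h0 hmin0
  linarith [key, hmono]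

end Fibre

/-! ## §5 Along Bałaban's normalisation `c₁·(ηL)² = c₀·L^d`, blocks of side `0 < ηL ≤ 1`: the strong constant is `γ(d,a)`, free of `m, L, η, c₀, c₁` -/

section Canonical

variable (L : ℕ) [NeZero L] (m : Fin d → ℕ) [∀ i, NeZero (fineP L m i)] (hL : 1 ≤ L) {c₀ c₁ : ℝ} [Fact (0 < c₀)] [Fact (0 < c₁)]
  {𝔸 : Type*} [NormedRing 𝔸] [NormedAlgebra ℂ 𝔸] [CompleteSpace 𝔸] [NormOneClass 𝔸]
  {W : Type*} [NormedAddCommGroup W] [InnerProductSpace ℂ W] [FiniteDimensional ℂ W] (φ : W ≃ₗ[ℂ] 𝔸)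
  {α : ℝ} (hα1 : α ≤ 1 / 64)
  (hU1 : ∀ (x : B7Prop1Explicit.Site d) (κ : Fin d), perCfg (fineP L m) (fun _ : Bond d (fineP L m) => (1 : 𝔸ˣ)) x κ ∈ U1 𝔸)
  (hreg : ∀ (y : TSite d m) (κ : Fin d) (r : Fin d → Fin L),
    ‖((Wcx L (perCfg (fineP L m) (fun _ : Bond d (fineP L m) => (1 : 𝔸ˣ))) (cornerSite L y) κ (boxVec L r) : 𝔸ˣ) : 𝔸) - 1‖ ≤ α)
  {η : ℝ} {a : ℝ} (ha : 0 < a)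

include ha

/-- **ALONG BAŁABAN's NORMALISATION THE STRONG CONSTANT IS `γ(d,a)`** — print's «γ₀ independent of k, T_η, and depending on d only (if we put a = 1)»
with its `Δ + I` rows: if `c₁·(ηL)² = c₀·L^d` ((3.16)'s `(L^jη)^{d−2}` against `η^d`; at `ηL = 1`: `c₁ = c₀L^d`) then `a″ = a`, and for blocks of side
`0 < ηL ≤ 1` the mass row's `(ηL)⁻² ≥ 1` is discarded: `γ(d,a)·(‖D(1)x‖² + ‖D*(1)x‖² + ‖x‖²) ≤ re⟨x, (D*D + D R(1) D* + aQ(1)†Q(1)) x⟩` — free of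
`m, L, η, c₀, c₁`.  On the diagonal `ηL = 1` (one pure-small-field step seen at its own scale) this is (1.90) verbatim in Hodge form.
[cite: Balaban1984PropagatorsI, Prop. 1.1 (1.90) p.33, (1.69) p.29; Balaban1985BackgroundPropagators, (3.16) p.393, (3.26) p.395, Thm 3.11 p.416] -/
theorem flat_strong_coercive_canonical (hηL0 : 0 < η * L) (hηL1 : η * L ≤ 1) (hs : c₁ * (η * L) ^ 2 = c₀ * (L : ℝ) ^ d)
    (x : BondL2K ℂ d (fineP L m) c₀ W) :
    (1 / ((d + 1 : ℝ) * B5Prop11Plancherel.Cst d a)) *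
        (‖covCurlL2K ℂ c₀ ((η : ℂ))⁻¹ (adTransportW φ (fun _ : Bond d (fineP L m) => (1 : 𝔸ˣ))) x‖ ^ 2 +
          ‖covDivL2K ℂ c₀ ((η : ℂ))⁻¹ (adTransportW φ fun _ : Bond d (fineP L m) => (1 : 𝔸ˣ)⁻¹) x‖ ^ 2 + ‖x‖ ^ 2) ≤
      RCLike.re ⟪x, laplaceALatticeK ((η : ℂ))⁻¹ (adTransportW φ (fun _ : Bond d (fineP L m) => (1 : 𝔸ˣ)))
        (adTransportW φ fun _ : Bond d (fineP L m) => (1 : 𝔸ˣ)⁻¹) (principalOpK φ η fun _ => 1) (RofU L m φ η fun _ => 1)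
        (QtorusW L m hL φ (fun _ => 1) hα1 hU1 hreg (c₁ := c₁)) a x⟫_ℂ := by
  have hc₀ : 0 < c₀ := Fact.out
  have hLr : (0 : ℝ) < L := by exact_mod_cast Nat.pos_of_ne_zero (NeZero.ne L)
  have hη : η ≠ 0 := by rintro rfl; rw [zero_mul] at hηL0; exact lt_irrefl _ hηL0
  have h := flat_strong_coercive_uniform L m hL φ (c₁ := c₁) hα1 hU1 hreg hη ha x
  -- `a″ = a` under the weight relation
  have hden : c₀ * (L : ℝ) ^ d ≠ 0 := by positivity
  have h1 : a * c₁ * (η * L) ^ 2 / (c₀ * (L : ℝ) ^ d) = a := by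
    rw [mul_assoc, hs, mul_div_assoc, div_self hden, mul_one]
  rw [h1] at h
  -- the block-side factor `(ηL)⁻² ≥ 1` on the mass row
  have hinv : (1 : ℝ) ≤ ((η * L)⁻¹) ^ 2 := by
    have h1le : (1 : ℝ) ≤ (η * L)⁻¹ := one_le_inv_iff₀.mpr ⟨hηL0, hηL1⟩
    nlinarith
  have hC : (1 : ℝ) ≤ B5Prop11Plancherel.Cst d a := B5Prop11Lower.one_le_Cst _
  have hγ : 0 ≤ 1 / ((d + 1 : ℝ) * B5Prop11Plancherel.Cst d a) := by positivity
  have hmass : ‖x‖ ^ 2 ≤ ((η * L)⁻¹) ^ 2 * ‖x‖ ^ 2 := le_mul_of_one_le_left (sq_nonneg _) hinv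
  refine le_trans ?_ h
  gcongr

end Canonical

section CanonicalExists

variable {𝔸 : Type*} [NormedRing 𝔸] [NormedAlgebra ℂ 𝔸] [CompleteSpace 𝔸] [NormOneClass 𝔸]
  {W : Type*} [NormedAddCommGroup W] [InnerProductSpace ℂ W] [FiniteDimensional ℂ W] (φ : W ≃ₗ[ℂ] 𝔸)
  {a : ℝ} (ha : 0 < a)

include ha

/-- **`∃ γ` BEFORE `∀ L ∀ η ∀ c₀ c₁ ∀ m`, STRONG FORM** — print's «independent of k, T_η, and depending on d only» for `Δ_a ≥ γ₀(Δ + I)` read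
in Hodge shape: ONE `γ = γ(d,a) > 0` with `γ·(‖D(1)x‖² + ‖D*(1)x‖² + ‖x‖²) ≤ re⟨x, (D*D + D R(1) D* + aQ(1)†Q(1)) x⟩` for EVERY block size `L ≥ 1`,
every spacing with blocks of side `0 < ηL ≤ 1`, every pair of weights in print's relation `c₁·(ηL)² = c₀·L^d`, every volume `m`, every bond function
(flat letters supplied, `α := 0`).  This is R2′ STEP B7′ S0 of the NE9 route file, in the chain's typed letters.
[cite: Balaban1984PropagatorsI, Prop. 1.1 (1.90) p.33, (1.69) p.29; Balaban1985BackgroundPropagators, (3.16) p.393, (3.26) p.395, Thm 3.11 p.416] -/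
theorem exists_strong_coercive_flat_canonical :
    ∃ γ : ℝ, 0 < γ ∧ ∀ (L : ℕ) [NeZero L] (hL : 1 ≤ L) (η : ℝ), 0 < η * L → η * L ≤ 1 →
      ∀ (c₀ c₁ : ℝ) [Fact (0 < c₀)] [Fact (0 < c₁)], c₁ * (η * L) ^ 2 = c₀ * (L : ℝ) ^ d →
      ∀ (m : Fin d → ℕ) [∀ i, NeZero (fineP L m i)] (x : BondL2K ℂ d (fineP L m) c₀ W),
      γ * (‖covCurlL2K ℂ c₀ ((η : ℂ))⁻¹ (adTransportW φ (fun _ : Bond d (fineP L m) => (1 : 𝔸ˣ))) x‖ ^ 2 +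
            ‖covDivL2K ℂ c₀ ((η : ℂ))⁻¹ (adTransportW φ fun _ : Bond d (fineP L m) => (1 : 𝔸ˣ)⁻¹) x‖ ^ 2 + ‖x‖ ^ 2) ≤
        RCLike.re ⟪x, laplaceALatticeK ((η : ℂ))⁻¹ (adTransportW φ (fun _ : Bond d (fineP L m) => (1 : 𝔸ˣ)))
          (adTransportW φ fun _ : Bond d (fineP L m) => (1 : 𝔸ˣ)⁻¹) (principalOpK φ η fun _ => 1) (RofU L m φ η fun _ => 1)
          (QtorusW L m hL φ (fun _ => 1) (show (0 : ℝ) ≤ 1 / 64 by norm_num) (hU1_one L m) (hreg_one L m) (c₁ := c₁)) a x⟫_ℂ := by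
  have hC : (1 : ℝ) ≤ B5Prop11Plancherel.Cst d a := B5Prop11Lower.one_le_Cst _
  refine ⟨1 / ((d + 1 : ℝ) * B5Prop11Plancherel.Cst d a), by positivity, fun L _ hL η hηL0 hηL1 c₀ c₁ _ _ hs m _ x => ?_⟩
  exact flat_strong_coercive_canonical L m hL φ (c₁ := c₁) _ (hU1_one L m) (hreg_one L m) ha hηL0 hηL1 hs x

end CanonicalExists

end Literature.MathematicalPhysics.QuantumFieldTheory.Balaban1983to89.B5Eq190FlatStrongFormTransfer

end
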